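import Summits.KontsevichZagierPeriods.KontsevichZagierPeriods.Theorems.RootDecompWalshStrataQuadricFourRung
import Summits.KontsevichZagierPeriods.KontsevichZagierPeriods.Theorems.RootDecompWalshStrataBall4Descent

/-!
# Route D `RootDecompWalshStrata` — the `d = 4` specimen plugged into the gen-11 node

Cell decomp-kz, lens 4, generation 11.  The node file types `QuadricFour ⟸ QuadricTwoDescent ∧
RationalTwoKernel` and isolates the new content of the lever as the slice `QuadricTwoDescentFour`
(`∀ P : ℚ[x₀..x₃], deg P ≤ 2, …`).  Here the slice is cut per quadric (`QuadricTwoDescentFourAt P`,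
`quadricTwoDescentFour_iff_forall_at`) and its FIRST INSTANCE is proved: the orthant of the unit 4-ball,
`P = 1 − x₀² − x₁² − x₂² − x₃²` (`quadricTwoDescentFourAt_ball4`, from `Ball4.ball4_twoDescent`: five
moves inside the three KZ rules land `[(0,1)⁴ ∩ {Σxᵢ² < 1}, q]` on the rational 2-cell
`[(0,1)², q/(8((1−t₀)²+t₀²)((1−t₁)²+t₁²))]`, value `q·π²/32`).  So at `d = 4` the extremal programme's
lever is exercised on the flagship weight-2 cell, and what remains of `QuadricTwoDescentFour` is the
same chart-and-descend routine for the other affine types of quadrics in four variables (censused in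
`census/data/qcell-v2/qcell_d4_seeds.json`), while the transcendence content of the rung sits isolated
in the oracle `RationalTwoKernel` (⟹ item 4280 `KZDimTwo`, ⟹ item 25394 `PlanarSignKernel`).  0 sorry.
[KontsevichZagier2001 §1.2]
-/

namespace Summit.KontsevichZagierPeriods.RootDecompWalshStrata.QuadricFourRung

open Literature.NumberTheory.Transcendental
open Summit.KontsevichZagierPeriods.RootDecompWalshStrata.Ball4 (ball4Poly ball4_twoDescent)

/-- The `d = 4` slice of the lever at a fixed quadric `P`. [KontsevichZagier2001 §1.2] -/
@[conjecture] def QuadricTwoDescentFourAt (P : MvPolynomial (Fin 4) ℚ) : Prop :=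
  ∀ (q : ℚ) (ρ : KZ.IntegralRep 4),
    (ρ.domain = {x | (∀ j, 0 < x j ∧ x j < 1) ∧ 0 < MvPolynomial.aeval x P} ∧
      ∀ x ∈ ρ.domain, ρ.integrand x = (q : ℝ)) →
    P.totalDegree ≤ 2 →
    ∃ y ∈ AddSubgroup.closure
      {y : KZ.FormalRep | ∃ (m : ℕ) (N : KZ.IntegralRep m), m ≤ 2 ∧ N.IsRational ∧ y = KZ.of N},
      KZ.of ρ - y ∈ KZ.relations

/-- `QuadricTwoDescentFour` is the conjunction of its slices over the quadrics `P`. [definition] -/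
theorem quadricTwoDescentFour_iff_forall_at :
    QuadricTwoDescentFour ↔ ∀ P, QuadricTwoDescentFourAt P := Iff.rfl

/-- `deg (1 − x₀² − x₁² − x₂² − x₃²) ≤ 2`. [folklore] -/
theorem totalDegree_ball4Poly_le : ball4Poly.totalDegree ≤ 2 := by
  unfold ball4Poly
  refine (MvPolynomial.totalDegree_sub _ _).trans (max_le ?_ ?_)
  · refine (MvPolynomial.totalDegree_sub _ _).trans (max_le ?_ ?_)
    · refine (MvPolynomial.totalDegree_sub _ _).trans (max_le ?_ ?_)
      · refine (MvPolynomial.totalDegree_sub _ _).trans (max_le ?_ ?_)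
        · simp
        · simp [MvPolynomial.totalDegree_X_pow]
      · simp [MvPolynomial.totalDegree_X_pow]
    · simp [MvPolynomial.totalDegree_X_pow]
  · simp [MvPolynomial.totalDegree_X_pow]

/-- **THE SPECIMEN of generation 11:** the slice of `QuadricTwoDescentFour` at the orthant of the unit
4-ball holds — decided inside the three KZ rules (`Ball4.ball4_twoDescent`).
[KontsevichZagier2001 §1.2; this node] -/
theorem quadricTwoDescentFourAt_ball4 : QuadricTwoDescentFourAt ball4Poly :=
  fun q ρ hρ _ => ball4_twoDescent q ρ hρ

/-- The specimen is an honest instance: `QuadricTwoDescentFour` specialises to it. [definition] -/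
theorem quadricTwoDescentFourAt_ball4_of_four (h : QuadricTwoDescentFour) :
    QuadricTwoDescentFourAt ball4Poly :=
  (quadricTwoDescentFour_iff_forall_at.mp h) ball4Poly

end Summit.KontsevichZagierPeriods.RootDecompWalshStrata.QuadricFourRung
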